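import Summits.Ventures.PercRepro.C041TriDomExcessMethod

/-!
# ROW C-041 — THE DELETION–CONTRACTION METHOD AT FOUR MARKS
(p6, gen 41; P6-TWOEXIT-LEAN.md §53 ADDENDUM 3)

The method of `C041TriDomExcessMethod` for FOUR marked vertices `a₁, u, u′, u″` of a host: the patterns are the Boolean
sextuples `(a₁ ~ u, a₁ ~ u′, a₁ ~ u″, u ~ u′, u ~ u″, u′ ~ u″)` of red / blue connectivity (`rsig6`, `bsig6`), always
transitive on the four triples (`Trans6`, `trans6_rsig6`), i.e. one of the FIFTEEN partitions of the four marks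
(`valid6`, `trans6_mem`); `Le6` is refinement, `comp6` the list of the 60 comparable pairs (`le6_mem`).  A functional
`F : P6 → P6 → ℤ` is admissible (`DCAdmissible6`) when it vanishes on the diagonal and satisfies THE KEY LEMMA's inequality
along one coarsening in each colour; `dcAdmissible6_of_chk` decides admissibility by a Boolean check over `valid6` and
`comp6` (a `decide +kernel`), for functionals given as a coefficient list on the binary encoding `enc6` (`Fof`).  The
recursion and the induction are those of the three-mark case (`sumF6_rec`, `sumF6_nonneg`): **every admissible `F` is a
theorem `0 ≤ Σ_ω F (π_R ω) (π_B ω)` for every finite host, every status and every four marks.**  The rays of the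
four-mark cone (kit j320333) are landed on this module (`C041TriDomExcessFourRaysA` …).
-/

namespace PercRepro

namespace ZoneZ

namespace MultiExit

open ZoneData Pendant Finset TwoExit TreeClosure RelaxedTriangle

variable {V₁ E₁ U₁ U₂ : Type} (Z₁ : ZoneData V₁ E₁ U₁ U₂) (u u' u'' a₁ : V₁)

/-! ## Four-point patterns -/

/-- A four-point connectivity pattern `(a₁ ~ u, a₁ ~ u′, a₁ ~ u″, u ~ u′, u ~ u″, u′ ~ u″)`. -/
abbrev P6 := Bool × Bool × Bool × Bool × Bool × Bool

/-- The pattern is transitive on the four triples (a partition of the four marks). -/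
def Trans6 (s : P6) : Prop :=
  (s.1 = true → s.2.1 = true → s.2.2.2.1 = true) ∧ (s.1 = true → s.2.2.2.1 = true → s.2.1 = true) ∧
    (s.2.1 = true → s.2.2.2.1 = true → s.1 = true) ∧
  (s.1 = true → s.2.2.1 = true → s.2.2.2.2.1 = true) ∧ (s.1 = true → s.2.2.2.2.1 = true → s.2.2.1 = true) ∧
    (s.2.2.1 = true → s.2.2.2.2.1 = true → s.1 = true) ∧
  (s.2.1 = true → s.2.2.1 = true → s.2.2.2.2.2 = true) ∧ (s.2.1 = true → s.2.2.2.2.2 = true → s.2.2.1 = true) ∧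
    (s.2.2.1 = true → s.2.2.2.2.2 = true → s.2.1 = true) ∧
  (s.2.2.2.1 = true → s.2.2.2.2.1 = true → s.2.2.2.2.2 = true) ∧
    (s.2.2.2.1 = true → s.2.2.2.2.2 = true → s.2.2.2.2.1 = true) ∧
    (s.2.2.2.2.1 = true → s.2.2.2.2.2 = true → s.2.2.2.1 = true)

/-- Transitivity is decidable. -/
instance (s : P6) : Decidable (Trans6 s) := by unfold Trans6; infer_instance

/-- `s` refines `t`. -/
def Le6 (s t : P6) : Prop :=
  (s.1 = true → t.1 = true) ∧ (s.2.1 = true → t.2.1 = true) ∧ (s.2.2.1 = true → t.2.2.1 = true) ∧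
    (s.2.2.2.1 = true → t.2.2.2.1 = true) ∧ (s.2.2.2.2.1 = true → t.2.2.2.2.1 = true) ∧
    (s.2.2.2.2.2 = true → t.2.2.2.2.2 = true)

/-- Refinement is decidable. -/
instance (s t : P6) : Decidable (Le6 s t) := by unfold Le6; infer_instance

/-- The fifteen partitions of the four marks. -/
def valid6 : List P6 := [(true, true, true, true, true, true), (true, true, false, true, false, false), (true, false, true, false, true, false), (true, false, false, false, false, true), (true, false, false, false, false, false), (false, true, true, false, false, true), (false, true, false, false, true, false), (false, true, false, false, false, false), (false, false, true, true, false, false), (false, false, false, true, true, true), (false, false, false, true, false, false), (false, false, true, false, false, false), (false, false, false, false, true, false), (false, false, false, false, false, true), (false, false, false, false, false, false)]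

/-- A transitive pattern is one of the fifteen partitions. -/
theorem trans6_mem : ∀ s : P6, Trans6 s → s ∈ valid6 := by decide

/-- The sixty comparable pairs of partitions (`s ≤ t`, `s = t` included). -/
def comp6 : List (P6 × P6) := [((true, true, true, true, true, true), (true, true, true, true, true, true)), ((true, true, false, true, false, false), (true, true, true, true, true, true)), ((true, true, false, true, false, false), (true, true, false, true, false, false)), ((true, false, true, false, true, false), (true, true, true, true, true, true)), ((true, false, true, false, true, false), (true, false, true, false, true, false)), ((true, false, false, false, false, true), (true, true, true, true, true, true)), ((true, false, false, false, false, true), (true, false, false, false, false, true)), ((true, false, false, false, false, false), (true, true, true, true, true, true)), ((true, false, false, false, false, false), (true, true, false, true, false, false)), ((true, false, false, false, false, false), (true, false, true, false, true, false)), ((true, false, false, false, false, false), (true, false, false, false, false, true)), ((true, false, false, false, false, false), (true, false, false, false, false, false)), ((false, true, true, false, false, true), (true, true, true, true, true, true)), ((false, true, true, false, false, true), (false, true, true, false, false, true)), ((false, true, false, false, true, false), (true, true, true, true, true, true)), ((false, true, false, false, true, false), (false, true, false, false, true, false)), ((false, true, false, false, false, false), (true, true, true, true, true, true)), ((false, true,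 false, false, false, false), (true, true, false, true, false, false)), ((false, true, false, false, false, false), (false, true, true, false, false, true)), ((false, true, false, false, false, false), (false, true, false, false, true, false)), ((false, true, false, false, false, false), (false, true, false, false, false, false)), ((false, false, true, true, false, false), (true, true, true, true, true, true)), ((false, false, true, true, false, false), (false, false, true, true, false, false)), ((false, false, false, true, true, true), (true, true, true, true, true, true)), ((false, false, false, true, true, true), (false, false, false, true, true, true)), ((false, false, false, true, false, false), (true, true, true, true, true, true)), ((false, false, false, true, false, false), (true, true, false, true, false, false)), ((false, false, false, true, false, false), (false, false, true, true, false, false)), ((false, false, false, true, false, false), (false, false, false, true, true, true)), ((false, false, false, true, false, false), (false, false, false, true, false, false)), ((false, false, true, false, false, false), (true, true, true, true, true, true)), ((false, false, true, false, false, false), (true, false, true, false, true, false)), ((false, false, true, false, false, false), (false, true, true, false, false, true)), ((false, false, true, false, false, false), (false, false, true, true, false, false)), ((false, false, true, false, false, false), (false, false, true, false, false, false)), ((false, false, false, false, true, false), (true, true, true, true, true, true)), ((false, false, false, false, true, false), (true, false, true, false, true, false)), ((false, false, false, false, true, false), (false, true, false, false, true, false)), ((false, false, false, false, true, false), (false,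 false, false, true, true, true)), ((false, false, false, false, true, false), (false, false, false, false, true, false)), ((false, false, false, false, false, true), (true, true, true, true, true, true)), ((false, false, false, false, false, true), (true, false, false, false, false, true)), ((false, false, false, false, false, true), (false, true, true, false, false, true)), ((false, false, false, false, false, true), (false, false, false, true, true, true)), ((false, false, false, false, false, true), (false, false, false, false, false, true)), ((false, false, false, false, false, false), (true, true, true, true, true, true)), ((false, false, false, false, false, false), (true, true, false, true, false, false)), ((false, false, false, false, false, false), (true, false, true, false, true, false)), ((false, false, false, false, false, false), (true, false, false, false, false, true)), ((false, false, false, false, false, false), (true, false, false, false, false, false)), ((false, false, false, false, false, false), (false, true, true, false, false, true)), ((false, false, false, false, false, false), (false, true, false, false, true, false)), ((false, false, false, false, false, false), (false, true, false, false, false, false)), ((false, false, false, false, false, false), (false, false, true, true, false, false)), ((false, false, false, false, false, false), (false, false, false, true, true, true)), ((false, false, false, false, false, false), (false, false, false, true, false, false)), ((false, false, false, false, false, false), (false, false, true, false, false, false)), ((false, false, false, false, false, false), (false, false, false, false, true, false)), ((false, false, false, false, false, false), (false, false, false, false, false, true)), ((false, false, false, false, false, false), (false, false, false, false, false, false))]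

/-- A comparable pair of partitions is in the list. -/
theorem le6_mem : ∀ s ∈ valid6, ∀ s' ∈ valid6, Le6 s s' → (s, s') ∈ comp6 := by decide

/-- The binary encoding of a pattern. -/
def enc6 (s : P6) : ℕ :=
  (if s.1 then 32 else 0) + (if s.2.1 then 16 else 0) + (if s.2.2.1 then 8 else 0) + (if s.2.2.2.1 then 4 else 0)
    + (if s.2.2.2.2.1 then 2 else 0) + (if s.2.2.2.2.2 then 1 else 0)

/-- A symmetric functional given by a list of coefficients `(enc s, enc t, c)` on unordered pairs. -/
def Fof (coefs : List (ℕ × ℕ × ℤ)) (s t : P6) : ℤ :=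
  (coefs.map fun x => if (enc6 s = x.1 ∧ enc6 t = x.2.1) ∨ (enc6 s = x.2.1 ∧ enc6 t = x.1) then x.2.2 else 0).sum

/-- A four-point functional admissible for the deletion–contraction method. -/
structure DCAdmissible6 (F : P6 → P6 → ℤ) : Prop where
  /-- the diagonal vanishes -/
  diag : ∀ s, Trans6 s → F s s = 0
  /-- the second mixed difference along one coarsening in each colour has the right sign -/
  key : ∀ s s' t t', Trans6 s ∧ Trans6 s' ∧ Trans6 t ∧ Trans6 t' ∧ Le6 s s' ∧ Le6 t t' →
    F s t + F s' t' ≤ F s' t + F s t'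

/-- The Boolean admissibility check of a functional over the partitions and the comparable pairs. -/
def chk6 (F : P6 → P6 → ℤ) : Bool :=
  valid6.all (fun s => decide (F s s = 0)) &&
    comp6.all (fun p => comp6.all (fun q => decide (F p.1 q.1 + F p.2 q.2 ≤ F p.2 q.1 + F p.1 q.2)))

/-- A functional passing the Boolean check is admissible. -/
theorem dcAdmissible6_of_chk (F : P6 → P6 → ℤ) (h : chk6 F = true) : DCAdmissible6 F := by
  unfold chk6 at h
  simp only [Bool.and_eq_true, List.all_eq_true, decide_eq_true_eq] at h
  refine ⟨fun s hs => h.1 s (trans6_mem s hs), fun s s' t t' ⟨hs, hs', ht, ht', hss', htt'⟩ => ?_⟩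
  exact h.2 (s, s') (le6_mem s (trans6_mem s hs) s' (trans6_mem s' hs') hss')
    (t, t') (le6_mem t (trans6_mem t ht) t' (trans6_mem t' ht') htt')

/-- The encoded partitions. -/
def valid6e : List ℕ := valid6.map enc6

/-- The encoded STRICTLY comparable pairs (the 45 pairs `s < t`; the equal pairs are trivial for the key inequality). -/
def comp6e : List (ℕ × ℕ) := (comp6.filter fun p => decide (p.1 ≠ p.2)).map fun p => (enc6 p.1, enc6 p.2)

/-- The Boolean admissibility check of a functional on the ENCODINGS (fast in the kernel: numerals only). -/
def chk6e (Fe : ℕ → ℕ → ℤ) : Bool :=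
  valid6e.all (fun a => decide (Fe a a = 0)) &&
    comp6e.all (fun p => comp6e.all (fun q => decide (Fe p.1 q.1 + Fe p.2 q.2 ≤ Fe p.2 q.1 + Fe p.1 q.2)))

/-- A functional on the encodings passing the Boolean check is admissible on the patterns. -/
theorem dcAdmissible6_of_chke (Fe : ℕ → ℕ → ℤ) (h : chk6e Fe = true) :
    DCAdmissible6 (fun s t => Fe (enc6 s) (enc6 t)) := by
  unfold chk6e at h
  simp only [Bool.and_eq_true, List.all_eq_true, decide_eq_true_eq] at h
  refine ⟨fun s hs => h.1 _ (List.mem_map_of_mem (trans6_mem s hs)),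
    fun s s' t t' ⟨hs, hs', ht, ht', hss', htt'⟩ => ?_⟩
  by_cases hss : s = s'
  · subst hss; omega
  by_cases htt : t = t'
  · subst htt; omega
  have h1 := h.2 (enc6 s, enc6 s')
    (List.mem_map_of_mem (f := fun p : P6 × P6 => (enc6 p.1, enc6 p.2))
      (List.mem_filter.mpr ⟨le6_mem s (trans6_mem s hs) s' (trans6_mem s' hs') hss', by simpa using hss⟩))
    (enc6 t, enc6 t')
    (List.mem_map_of_mem (f := fun p : P6 × P6 => (enc6 p.1, enc6 p.2))
      (List.mem_filter.mpr ⟨le6_mem t (trans6_mem t ht) t' (trans6_mem t' ht') htt', by simpa using htt⟩))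
  exact h1

/-! ## The patterns of a colouring -/

open Classical in
/-- The red four-point pattern of a colouring under a status. -/
noncomputable def rsig6 (st : E₁ → EStat) (ω : E₁ → Bool) : P6 :=
  (decide (RdS Z₁ st ω a₁ u), decide (RdS Z₁ st ω a₁ u'), decide (RdS Z₁ st ω a₁ u''),
    decide (RdS Z₁ st ω u u'), decide (RdS Z₁ st ω u u''), decide (RdS Z₁ st ω u' u''))

open Classical in
/-- The blue four-point pattern of a colouring under a status. -/
noncomputable def bsig6 (st : E₁ → EStat) (ω : E₁ → Bool) : P6 :=
  (decide (MgS Z₁ st ω a₁ u), decide (MgS Z₁ st ω a₁ u'), decide (MgS Z₁ st ω a₁ u''),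
    decide (MgS Z₁ st ω u u'), decide (MgS Z₁ st ω u u''), decide (MgS Z₁ st ω u' u''))

/-- The three transitivity implications of one triple `(k, v, w)` for a symmetric relation. -/
theorem tri_trans {R : V₁ → V₁ → Prop} (hR : ∀ x y, R x y → R y x) (k v w : V₁) :
    (v ∈ ZoneData.reach R {k} → w ∈ ZoneData.reach R {k} → w ∈ ZoneData.reach R {v}) ∧
    (v ∈ ZoneData.reach R {k} → w ∈ ZoneData.reach R {v} → w ∈ ZoneData.reach R {k}) ∧
    (w ∈ ZoneData.reach R {k} → w ∈ ZoneData.reach R {v} → v ∈ ZoneData.reach R {k}) :=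
  ⟨fun h1 h2 => reach_trans_of_symm hR h1 h2, fun h1 h2 => reach_trans' h1 h2,
    fun h1 h2 => reach_trans' h1 (reach_trans_of_symm hR h2 (mem_reach_self _ _))⟩

/-- The red pattern is a partition. -/
theorem trans6_rsig6 (st : E₁ → EStat) (ω : E₁ → Bool) : Trans6 (rsig6 Z₁ u u' u'' a₁ st ω) := by
  simp only [Trans6, rsig6, decide_eq_true_eq, RdS]
  have hR := RAdjS_symm Z₁ st ω
  obtain ⟨a1, a2, a3⟩ := tri_trans hR a₁ u u'
  obtain ⟨b1, b2, b3⟩ := tri_trans hR a₁ u u''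
  obtain ⟨c1, c2, c3⟩ := tri_trans hR a₁ u' u''
  obtain ⟨d1, d2, d3⟩ := tri_trans hR u u' u''
  exact ⟨a1, a2, a3, b1, b2, b3, c1, c2, c3, d1, d2, d3⟩

/-- The blue pattern is a partition. -/
theorem trans6_bsig6 (st : E₁ → EStat) (ω : E₁ → Bool) : Trans6 (bsig6 Z₁ u u' u'' a₁ st ω) := by
  simp only [Trans6, bsig6, decide_eq_true_eq, MgS]
  have hB := BAdjS_symm Z₁ st ω
  obtain ⟨a1, a2, a3⟩ := tri_trans hB a₁ u u'
  obtain ⟨b1, b2, b3⟩ := tri_trans hB a₁ u u''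
  obtain ⟨c1, c2, c3⟩ := tri_trans hB a₁ u' u''
  obtain ⟨d1, d2, d3⟩ := tri_trans hB u u' u''
  exact ⟨a1, a2, a3, b1, b2, b3, c1, c2, c3, d1, d2, d3⟩

/-- Equal red adjacencies give equal red patterns. -/
theorem rsig6_congr {st st' : E₁ → EStat} {ω ω' : E₁ → Bool} (h : RAdjS Z₁ st ω = RAdjS Z₁ st' ω') :
    rsig6 Z₁ u u' u'' a₁ st ω = rsig6 Z₁ u u' u'' a₁ st' ω' := by
  simp only [rsig6, RdS, Prod.mk.injEq, decide_eq_decide, h, iff_self, and_self]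

/-- Equal blue adjacencies give equal blue patterns. -/
theorem bsig6_congr {st st' : E₁ → EStat} {ω ω' : E₁ → Bool} (h : BAdjS Z₁ st ω = BAdjS Z₁ st' ω') :
    bsig6 Z₁ u u' u'' a₁ st ω = bsig6 Z₁ u u' u'' a₁ st' ω' := by
  simp only [bsig6, MgS, Prod.mk.injEq, decide_eq_decide, h, iff_self, and_self]

/-! ## Changing the status of one edge -/

variable [DecidableEq E₁]

/-- Colouring a free edge red: the red adjacency is that of the contraction. -/
theorem RAdjS_of_true {st : E₁ → EStat} {f : E₁} (hf : st f = .free) {ω : E₁ → Bool} (hω : ω f = true) :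
    RAdjS Z₁ st ω = RAdjS Z₁ (Function.update st f .double) ω := by
  refine RAdjS_congr Z₁ fun e => ?_
  by_cases he : e = f
  · subst he; simp [redE, hf, hω]
  · simp [redE, Function.update_of_ne he]

/-- Colouring a free edge blue: the red adjacency is that of the deletion. -/
theorem RAdjS_of_false {st : E₁ → EStat} {f : E₁} (hf : st f = .free) {ω : E₁ → Bool} (hω : ω f = false) :
    RAdjS Z₁ st ω = RAdjS Z₁ (Function.update st f .absent) ω := by
  refine RAdjS_congr Z₁ fun e => ?_
  by_cases he : e = f
  · subst he; simp [redE, hf, hω]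
  · simp [redE, Function.update_of_ne he]

/-- Colouring a free edge red: the blue adjacency is that of the deletion. -/
theorem BAdjS_of_true {st : E₁ → EStat} {f : E₁} (hf : st f = .free) {ω : E₁ → Bool} (hω : ω f = true) :
    BAdjS Z₁ st ω = BAdjS Z₁ (Function.update st f .absent) ω := by
  refine BAdjS_congr Z₁ fun e => ?_
  by_cases he : e = f
  · subst he; simp [blueE, hf, hω]
  · simp [blueE, Function.update_of_ne he]

/-- Colouring a free edge blue: the blue adjacency is that of the contraction. -/
theorem BAdjS_of_false {st : E₁ → EStat} {f : E₁} (hf : st f = .free) {ω : E₁ → Bool} (hω : ω f = false) :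
    BAdjS Z₁ st ω = BAdjS Z₁ (Function.update st f .double) ω := by
  refine BAdjS_congr Z₁ fun e => ?_
  by_cases he : e = f
  · subst he; simp [blueE, hf, hω]
  · simp [blueE, Function.update_of_ne he]

/-- A non-free edge ignores its colour (red adjacency). -/
theorem RAdjS_update_nonfree (st : E₁ → EStat) (f : E₁) {s : EStat} (hs : s ≠ .free) (ω : E₁ → Bool) (b : Bool) :
    RAdjS Z₁ (Function.update st f s) (Function.update ω f b) = RAdjS Z₁ (Function.update st f s) ω := by
  refine RAdjS_congr Z₁ fun e => ?_
  by_cases he : e = f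
  · subst he; simp [redE, hs]
  · simp [redE, Function.update_of_ne he]

/-- A non-free edge ignores its colour (blue adjacency). -/
theorem BAdjS_update_nonfree (st : E₁ → EStat) (f : E₁) {s : EStat} (hs : s ≠ .free) (ω : E₁ → Bool) (b : Bool) :
    BAdjS Z₁ (Function.update st f s) (Function.update ω f b) = BAdjS Z₁ (Function.update st f s) ω := by
  refine BAdjS_congr Z₁ fun e => ?_
  by_cases he : e = f
  · subst he; simp [blueE, hs]
  · simp [blueE, Function.update_of_ne he]

/-- Contracting an edge only coarsens the red pattern of its deletion. -/
theorem le6_rsig6 (st : E₁ → EStat) (f : E₁) (ω : E₁ → Bool) :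
    Le6 (rsig6 Z₁ u u' u'' a₁ (Function.update st f .absent) ω)
      (rsig6 Z₁ u u' u'' a₁ (Function.update st f .double) ω) := by
  have h : ∀ x y, RAdjS Z₁ (Function.update st f .absent) ω x y → RAdjS Z₁ (Function.update st f .double) ω x y := by
    intro x y ⟨e, he, hr⟩
    refine ⟨e, he, ?_⟩
    by_cases hef : e = f
    · subst hef; simp [redE]
    · simpa [redE, Function.update_of_ne hef] using hr
  simp only [Le6, rsig6, RdS, decide_eq_true_eq]
  exact ⟨reach_mono h, reach_mono h, reach_mono h, reach_mono h, reach_mono h, reach_mono h⟩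

/-- Contracting an edge only coarsens the blue pattern of its deletion. -/
theorem le6_bsig6 (st : E₁ → EStat) (f : E₁) (ω : E₁ → Bool) :
    Le6 (bsig6 Z₁ u u' u'' a₁ (Function.update st f .absent) ω)
      (bsig6 Z₁ u u' u'' a₁ (Function.update st f .double) ω) := by
  have h : ∀ x y, BAdjS Z₁ (Function.update st f .absent) ω x y → BAdjS Z₁ (Function.update st f .double) ω x y := by
    intro x y ⟨e, he, hb⟩
    refine ⟨e, he, ?_⟩
    by_cases hef : e = f
    · subst hef; simp [blueE]
    · simpa [blueE, Function.update_of_ne hef] using hb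
  simp only [Le6, bsig6, MgS, decide_eq_true_eq]
  exact ⟨reach_mono h, reach_mono h, reach_mono h, reach_mono h, reach_mono h, reach_mono h⟩

/-! ## The recursion and the induction -/

/-- The pointwise gap of the recursion for `F`. -/
noncomputable def gap6 (F : P6 → P6 → ℤ) (st : E₁ → EStat) (f : E₁) (ω : E₁ → Bool) : ℤ :=
  F (rsig6 Z₁ u u' u'' a₁ (Function.update st f .double) ω) (bsig6 Z₁ u u' u'' a₁ (Function.update st f .absent) ω)
    + F (rsig6 Z₁ u u' u'' a₁ (Function.update st f .absent) ω) (bsig6 Z₁ u u' u'' a₁ (Function.update st f .double) ω)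
    - F (rsig6 Z₁ u u' u'' a₁ (Function.update st f .absent) ω) (bsig6 Z₁ u u' u'' a₁ (Function.update st f .absent) ω)
    - F (rsig6 Z₁ u u' u'' a₁ (Function.update st f .double) ω) (bsig6 Z₁ u u' u'' a₁ (Function.update st f .double) ω)

/-- The gap of an admissible functional is non-negative. -/
theorem gap6_nonneg {F : P6 → P6 → ℤ} (hF : DCAdmissible6 F) (st : E₁ → EStat) (f : E₁) (ω : E₁ → Bool) :
    0 ≤ gap6 Z₁ u u' u'' a₁ F st f ω := by
  have := hF.key _ _ _ _ ⟨trans6_rsig6 Z₁ u u' u'' a₁ (Function.update st f .absent) ω,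
    trans6_rsig6 Z₁ u u' u'' a₁ (Function.update st f .double) ω,
    trans6_bsig6 Z₁ u u' u'' a₁ (Function.update st f .absent) ω,
    trans6_bsig6 Z₁ u u' u'' a₁ (Function.update st f .double) ω,
    le6_rsig6 Z₁ u u' u'' a₁ st f ω, le6_bsig6 Z₁ u u' u'' a₁ st f ω⟩
  unfold gap6
  linarith

/-- Colouring `f` red or blue: the two summands of the recursion. -/
theorem summand6_add_flip (F : P6 → P6 → ℤ) (st : E₁ → EStat) (f : E₁) (hf : st f = .free) (ω : E₁ → Bool) :
    F (rsig6 Z₁ u u' u'' a₁ st ω) (bsig6 Z₁ u u' u'' a₁ st ω)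
        + F (rsig6 Z₁ u u' u'' a₁ st (flipC f ω)) (bsig6 Z₁ u u' u'' a₁ st (flipC f ω)) =
      F (rsig6 Z₁ u u' u'' a₁ (Function.update st f .double) ω) (bsig6 Z₁ u u' u'' a₁ (Function.update st f .absent) ω)
        + F (rsig6 Z₁ u u' u'' a₁ (Function.update st f .absent) ω)
          (bsig6 Z₁ u u' u'' a₁ (Function.update st f .double) ω) := by
  have hd : EStat.double ≠ EStat.free := by decide
  have ha : EStat.absent ≠ EStat.free := by decide
  by_cases hω : ω f = true
  · have hω' : flipC f ω f = false := by simp [flipC_apply_self, hω]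
    rw [rsig6_congr Z₁ u u' u'' a₁ (RAdjS_of_true Z₁ hf hω), bsig6_congr Z₁ u u' u'' a₁ (BAdjS_of_true Z₁ hf hω),
      rsig6_congr Z₁ u u' u'' a₁ (RAdjS_of_false Z₁ hf hω'), bsig6_congr Z₁ u u' u'' a₁ (BAdjS_of_false Z₁ hf hω')]
    unfold flipC
    rw [rsig6_congr Z₁ u u' u'' a₁ (RAdjS_update_nonfree Z₁ st f ha ω _),
      bsig6_congr Z₁ u u' u'' a₁ (BAdjS_update_nonfree Z₁ st f hd ω _)]
  · have hω0 : ω f = false := by simpa using hω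
    have hω' : flipC f ω f = true := by simp [flipC_apply_self, hω0]
    rw [rsig6_congr Z₁ u u' u'' a₁ (RAdjS_of_false Z₁ hf hω0), bsig6_congr Z₁ u u' u'' a₁ (BAdjS_of_false Z₁ hf hω0),
      rsig6_congr Z₁ u u' u'' a₁ (RAdjS_of_true Z₁ hf hω'), bsig6_congr Z₁ u u' u'' a₁ (BAdjS_of_true Z₁ hf hω')]
    unfold flipC
    rw [rsig6_congr Z₁ u u' u'' a₁ (RAdjS_update_nonfree Z₁ st f hd ω _),
      bsig6_congr Z₁ u u' u'' a₁ (BAdjS_update_nonfree Z₁ st f ha ω _)]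
    exact add_comm _ _

variable [Fintype E₁]

open Classical in
/-- The sum of `F` over all colourings of a status. -/
noncomputable def sumF6 (F : P6 → P6 → ℤ) (st : E₁ → EStat) : ℤ :=
  ∑ ω : E₁ → Bool, F (rsig6 Z₁ u u' u'' a₁ st ω) (bsig6 Z₁ u u' u'' a₁ st ω)

/-- **THE RECURSION** at four marks. -/
theorem sumF6_rec (F : P6 → P6 → ℤ) (st : E₁ → EStat) (f : E₁) (hf : st f = .free) :
    2 * sumF6 Z₁ u u' u'' a₁ F st = sumF6 Z₁ u u' u'' a₁ F (Function.update st f .absent)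
      + sumF6 Z₁ u u' u'' a₁ F (Function.update st f .double) + ∑ ω : E₁ → Bool, gap6 Z₁ u u' u'' a₁ F st f ω := by
  have hflip : ∑ ω : E₁ → Bool, F (rsig6 Z₁ u u' u'' a₁ st ω) (bsig6 Z₁ u u' u'' a₁ st ω) =
      ∑ ω : E₁ → Bool, F (rsig6 Z₁ u u' u'' a₁ st (flipC f ω)) (bsig6 Z₁ u u' u'' a₁ st (flipC f ω)) :=
    (Equiv.sum_comp (flipPerm f) (fun ω => F (rsig6 Z₁ u u' u'' a₁ st ω) (bsig6 Z₁ u u' u'' a₁ st ω))).symm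
  have h2 : 2 * sumF6 Z₁ u u' u'' a₁ F st = ∑ ω : E₁ → Bool,
      (F (rsig6 Z₁ u u' u'' a₁ st ω) (bsig6 Z₁ u u' u'' a₁ st ω)
        + F (rsig6 Z₁ u u' u'' a₁ st (flipC f ω)) (bsig6 Z₁ u u' u'' a₁ st (flipC f ω))) := by
    rw [Finset.sum_add_distrib, ← hflip, sumF6]; ring
  rw [h2, sumF6, sumF6, ← Finset.sum_add_distrib, ← Finset.sum_add_distrib]
  refine Finset.sum_congr rfl fun ω _ => ?_
  rw [summand6_add_flip Z₁ u u' u'' a₁ F st f hf ω]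
  unfold gap6
  ring

omit [DecidableEq E₁] [Fintype E₁] in
/-- Without free edges the red and the blue patterns coincide. -/
theorem rsig6_eq_bsig6_of_nofree (st : E₁ → EStat) (hst : ∀ e, st e ≠ .free) (ω : E₁ → Bool) :
    rsig6 Z₁ u u' u'' a₁ st ω = bsig6 Z₁ u u' u'' a₁ st ω := by
  have h : RAdjS Z₁ st ω = BAdjS Z₁ st ω := by
    funext x y
    refine propext (exists_congr fun e => and_congr_right fun _ => ?_)
    simp [redE, blueE, hst e]
  simp only [rsig6, bsig6, RdS, MgS, Prod.mk.injEq, decide_eq_decide, h, iff_self, and_self]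

/-- Without free edges the sum of an admissible functional vanishes. -/
theorem sumF6_of_nofree {F : P6 → P6 → ℤ} (hF : DCAdmissible6 F) (st : E₁ → EStat) (hst : ∀ e, st e ≠ .free) :
    sumF6 Z₁ u u' u'' a₁ F st = 0 := by
  unfold sumF6
  refine Finset.sum_eq_zero fun ω _ => ?_
  rw [rsig6_eq_bsig6_of_nofree Z₁ u u' u'' a₁ st hst ω]
  exact hF.diag _ (trans6_bsig6 Z₁ u u' u'' a₁ st ω)

/-- **THE METHOD AT FOUR MARKS**: the sum of an admissible functional over the colourings of any status is
non-negative. -/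
theorem sumF6_nonneg {F : P6 → P6 → ℤ} (hF : DCAdmissible6 F) (st : E₁ → EStat) : 0 ≤ sumF6 Z₁ u u' u'' a₁ F st := by
  suffices h : ∀ n : ℕ, ∀ st : E₁ → EStat, nfree st = n → 0 ≤ sumF6 Z₁ u u' u'' a₁ F st from h _ st rfl
  intro n
  induction n with
  | zero =>
    intro st hst
    have hno : ∀ e, st e ≠ .free := by
      intro e he
      have : e ∈ (univ.filter fun e => st e = .free) := by simp [he]
      rw [Finset.card_eq_zero.mp hst] at this
      simp at this
    rw [sumF6_of_nofree Z₁ u u' u'' a₁ hF st hno]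
  | succ n ih =>
    intro st hst
    have hne : (univ.filter fun e => st e = .free).Nonempty := by
      rw [← Finset.card_pos]; unfold nfree at hst; omega
    obtain ⟨f, hf⟩ := hne
    have hf' : st f = .free := (Finset.mem_filter.mp hf).2
    have ha := ih (Function.update st f .absent) (by
      have := nfree_update hf' (s := .absent) (by decide); omega)
    have hd := ih (Function.update st f .double) (by
      have := nfree_update hf' (s := .double) (by decide); omega)
    have hg : 0 ≤ ∑ ω : E₁ → Bool, gap6 Z₁ u u' u'' a₁ F st f ω :=
      Finset.sum_nonneg fun ω _ => gap6_nonneg Z₁ u u' u'' a₁ hF st f ω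
    have := sumF6_rec Z₁ u u' u'' a₁ F st f hf'
    linarith

open Classical in
/-- **THE METHOD AT FOUR MARKS, ALL EDGES FREE**: for an admissible `F`, the sum over the colourings of the host of
`F` at the red and blue partitions of the four marks is non-negative. -/
theorem sumF6_free_nonneg {F : P6 → P6 → ℤ} (hF : DCAdmissible6 F) :
    0 ≤ ∑ ω : E₁ → Bool, F (rsig6 Z₁ u u' u'' a₁ (fun _ => EStat.free) ω) (bsig6 Z₁ u u' u'' a₁ (fun _ => EStat.free) ω) :=
  sumF6_nonneg Z₁ u u' u'' a₁ hF _

end MultiExit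

end ZoneZ

end PercRepro
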